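import Literature.Analysis.FluidPDE.RusinSverakSingularTimeProofs
import Literature.Analysis.FluidPDE.KatoFarFieldBound
import Literature.Analysis.FluidPDE.RusinSverakSingularPointProofs
import HarnessLib

/-!
# A finite maximal time forces a singularity at `t = T_max(u₀)` (Rusin–Šverák 2011, §4) — discharged

Analysis/FluidPDE glue file **discharging the named fact
`Literature.Analysis.FluidPDE.rusin_sverak_singularity_at_katoMaximalTime`**
(`RusinSverakSingularTime.lean`; W. Rusin, V. Šverák, *Minimal initial data for potential
Navier–Stokes singularities*, J. Funct. Anal. 260 (2011) 879–891 = arXiv:0911.0500, §4 pp. 6–7,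
the paragraph after Thm. 4.1: "the only reason for `T_max(u₀) < ∞` can be a finite time
singularity"). The accepted tree reduction is
`rusin_sverak_singularity_at_katoMaximalTime_of_continuation` (`RusinSverakSingularTimeProofs.lean`:
the statement from Kato's local theory, the `L^∞` continuation of Kato solutions and their
far-field bound near the final time), and all three inputs are discharged: `kato_local_holds`
(`KatoLocalHolds.lean`), `IsKatoSolutionOn.continuation_of_bounded_holds`
(`RusinSverakSingularPointProofs.lean`) and `IsKatoSolutionOn.farField_bound_holds`
(`KatoFarFieldBound.lean`, the Calderón / Rusin–Šverák splitting route).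

Theorem-only glue module: no definitions, no named facts, no `sorry`; the theorem is a
composition of an accepted tree reduction with accepted discharges (pure proof of an unchanged
statement).

## References

* W. Rusin, V. Šverák, *Minimal initial data for potential Navier–Stokes singularities*,
  J. Funct. Anal. 260 (2011) 879–891 = arXiv:0911.0500, §4 pp. 6–7 (paragraph after Thm. 4.1),
  §3 (3.14), Prop. 4.1, Prop. 2.1. [RusinSverak2011]
* P. G. Lemarié-Rieusset, *The Navier–Stokes Problem in the 21st Century*, CRC Press 2016,
  Thm. 15.1 (C) (PDF pp. 565–566). [LemarieRieusset2016]
-/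

noncomputable section

namespace Literature.Analysis.FluidPDE

/-- **Rusin–Šverák 2011, §4: a finite maximal time `T_max(u₀)` carries a singular point
`(T_max, x_*)` of the maximal Kato solution, proved** (the named statement
`rusin_sverak_singularity_at_katoMaximalTime`), by
`rusin_sverak_singularity_at_katoMaximalTime_of_continuation` with `kato_local_holds`,
`IsKatoSolutionOn.continuation_of_bounded_holds` and `IsKatoSolutionOn.farField_bound_holds`.
[cite: RusinSverak2011, §4 pp. 6–7 (paragraph after Thm. 4.1) with §3 (3.14), Prop. 4.1, Thm. 4.1, Prop. 2.1 (arXiv:0911.0500)] -/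
theorem rusin_sverak_singularity_at_katoMaximalTime_holds :
    rusin_sverak_singularity_at_katoMaximalTime :=
  rusin_sverak_singularity_at_katoMaximalTime_of_continuation kato_local_holds
    IsKatoSolutionOn.continuation_of_bounded_holds IsKatoSolutionOn.farField_bound_holds

end Literature.Analysis.FluidPDE

end
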